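import Literature.AlgebraicTopology.SingularHomology.CechCapBridge
import Literature.AlgebraicTopology.SingularHomology.CupProduct
import HarnessLib

/-!
# Right cup product of cochains of a simplex span by a global cochain

Topic `Literature/AlgebraicTopology/SingularHomology`. A. Hatcher, *Algebraic Topology* (2002),
§3.2 p. 209 (the relative cup product: "the cochain cup product restricts to a cup product
`Cᵏ(X, A) × Cˡ(X) → Cᵏ⁺ˡ(X, A)` … since `Cⁿ(X; R)` acts on the cochains vanishing on chains in
`A`"; dually it acts on the cochains OF an open subset and on the `𝒰`-small cochains of
Prop. 2.21) and Lemma 3.6 (`δ(φ ⌣ ψ) = δφ ⌣ ψ ± φ ⌣ δψ`): the module structure of the cochains of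
subsets over the global cochains, the input for the `H*(X)`-linearity of Mayer–Vietoris
coboundaries (Husemoller, *Fibre Bundles*, Ch. 17 §1, proof of the Leray–Hirsch theorem 1.1:
"`θ_U (Σ cᵢ xᵢ) = Σ p*(cᵢ) aᵢ` … commutative diagram with exact [Mayer–Vietoris] rows").

For the tree's simplex spans `𝒮` (`SimplexSpan`, `CechCapProduct.lean`: face-closed families of
singular simplices of `X` spanning subcomplexes of `C(X)`; `ofSet W = C(W)` whose dual is
`subsetCochains R 𝑹 W`, and `ofSets A B = C(A) + C(B)`) closed under front and back faces, and a
function cochain `β ∈ Cᵈ(X; R)` of the whole space, we define and study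

* `SimplexSpan.coextOf 𝒮 φ` — the cochain of `Hom(𝒮ₖ, 𝑹)` of a function cochain (`toFun_coextOf`),
  `SimplexSpan.hom_ext_toFun` — cochains of `Hom(𝒮ₖ, 𝑹)` are determined by their function cochains;
* `SimplexSpan.cupRight 𝒮 β h ψ = ψ ⌣ β ∈ Hom(𝒮ₙ, 𝑹)` (`p + d = n`): on a simplex `σ` of the
  family, `ψ(σ|[v₀…vₚ]) · β(σ|[vₚ…vₙ])` (`toFun_cupRight`); `R`-linear in `ψ`;
* `SimplexSpan.d_cupRight` — **Leibniz**: `δ(ψ ⌣ β) = δψ ⌣ β` when `β` is a cocycle of `X`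
  (from the tree's `d_cochainCup` on `X`, restricted to the family);
* `SimplexSpan.incl_cupRight` — `⌣ β` commutes with the restriction maps `Hom(𝒮, 𝑹) → Hom(𝒮', 𝑹)`
  of spans `𝒮' ≤ 𝒮` (in particular with `subsetCochains.res` and with the small-cochain
  restriction of Mayer–Vietoris).

Everything is proved; no named facts.

## References

* [HatcherAT2002] A. Hatcher, *Algebraic Topology*, CUP 2002, §3.2 p. 206 (cup product), p. 209
  (relative cup product), Lemma 3.6; §2.1, Prop. 2.21.
* [HusemollerFibreBundles1994] D. Husemoller, *Fibre Bundles*, 3rd ed. (1994), Ch. 17 §1,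
  Thm. 1.1 (proof).
-/

noncomputable section

-- as in `CechCapProduct` / `CechCapBridge`: chains of the concrete complex are `Finsupp`s
-- up to unfolding of semireducible definitions
set_option backward.isDefEq.respectTransparency false

open CategoryTheory Limits

universe u v

namespace Literature.AlgebraicTopology.SingularHomology

namespace SimplexSpan

variable {R : Type v} [CommRing R] {X : Type u} [TopologicalSpace X]

/-- Local notation: the coefficient object `R` of `ModuleCat.{max u v} R`. -/
local notation "𝑹" => SimplexSpan.coefR R

/-- Local notation: the simplex span `C(univ)` of all simplices. -/
local notation "𝒰" => (SimplexSpan.ofSet (R := R) (Set.univ : Set X))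

variable (𝒮 : SimplexSpan R X)

/-! ### Cochains of a span are function cochains on the family -/

/-- Every simplex span is contained in `C(univ)`. [folklore] -/
theorem sub_le_univ : 𝒮.sub ≤ (𝒰).sub := by
  intro k c _
  change c ∈ chainsIn R R X Set.univ k
  rw [mem_chainsIn_iff]
  exact fun σ _ ↦ Set.subset_univ _

/-- **Two cochains of `Hom(𝒮ₖ, 𝑹)` with the same function cochain on the family are equal**
(`𝒮ₖ` is spanned by the elementary chains of the simplices of the family; Hatcher 2002, §2.1).
[cite: HatcherAT2002, §2.1] -/
theorem hom_ext_toFun {k : ℕ} {ψ ψ' : 𝒮.sub.toComplex.X k ⟶ 𝑹}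
    (h : ∀ σ ∈ 𝒮.carrier k, 𝒮.toFun ψ σ = 𝒮.toFun ψ' σ) : ψ = ψ' := by
  classical
  apply ModuleCat.hom_ext
  -- the restriction of an arbitrary chain to the family, landing in the subcomplex
  let f : CChain R X k →ₗ[R] CChain R X k :=
    (Finsupp.supported R R (𝒮.carrier k)).subtype ∘ₗ Finsupp.restrictDom R R (𝒮.carrier k)
  have hf : ∀ c, f c = Finsupp.filter (· ∈ 𝒮.carrier k) c := fun c ↦ rfl
  have hfmem : ∀ c : CChain R X k, f c ∈ 𝒮.sub k := fun c ↦ (𝒮.mem_sub_iff' _).2 (by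
    intro σ hσ
    rw [hf, Finset.mem_coe, Finsupp.mem_support_iff, Finsupp.filter_apply] at hσ
    by_contra hn
    exact hσ (if_neg hn))
  let ρ : CChain R X k →ₗ[R] 𝒮.sub.toComplex.X k := LinearMap.codRestrict (𝒮.sub k) f hfmem
  have hρ : ∀ c, (ρ c).1 = Finsupp.filter (· ∈ 𝒮.carrier k) c := fun c ↦ rfl
  have key : ψ.hom ∘ₗ ρ = ψ'.hom ∘ₗ ρ := by
    refine Finsupp.lhom_ext fun σ b ↦ ?_
    change ψ.hom (ρ (Finsupp.single σ b)) = ψ'.hom (ρ (Finsupp.single σ b))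
    by_cases hσ : σ ∈ 𝒮.carrier k
    · have e : ρ (Finsupp.single σ b) = b • (⟨Finsupp.single σ 1, 𝒮.single_mem hσ 1⟩ :
          𝒮.sub.toComplex.X k) := by
        apply Subtype.ext
        rw [hρ, Finsupp.filter_single_of_pos _ hσ, Submodule.coe_smul, Finsupp.smul_single,
          smul_eq_mul, mul_one]
      rw [e, map_smul, map_smul]
      have h1 := h σ hσ
      rw [𝒮.toFun_apply_of_mem _ hσ, 𝒮.toFun_apply_of_mem _ hσ] at h1
      have h2 : ψ ⟨Finsupp.single σ 1, 𝒮.single_mem hσ 1⟩ = ψ' ⟨Finsupp.single σ 1, 𝒮.single_mem hσ 1⟩ :=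
        ULift.ext _ _ h1
      exact congrArg (b • ·) h2
    · have e : ρ (Finsupp.single σ b) = 0 := by
        apply Subtype.ext
        rw [hρ, Finsupp.filter_single_of_neg _ hσ, Submodule.coe_zero]
      rw [e, map_zero, map_zero]
  -- every chain of the subcomplex is its own restriction
  refine LinearMap.ext fun c ↦ ?_
  have hc : ρ c.1 = c := by
    apply Subtype.ext
    rw [hρ, Finsupp.filter_eq_self_iff]
    intro σ hσ
    exact 𝒮.mem_carrier_of_mem_support c.2 (Finsupp.mem_support_iff.2 hσ)
  have := LinearMap.congr_fun key c.1
  simp only [LinearMap.coe_comp, Function.comp_apply, hc] at this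
  exact this

/-- **The cochain of `Hom(𝒮ₖ, 𝑹)` of a function cochain**: restrict the tree's `coext` (for
`C(univ)`) to the span. [cite: HatcherAT2002, §3.1 p. 197] -/
def coextOf {k : ℕ} (φ : SingularSimplex X k → R) : 𝒮.sub.toComplex.X k ⟶ 𝑹 :=
  (Subcomplex.incl 𝒮.sub_le_univ).f k ≫ subsetCochains.coext φ

/-- The function cochain of `coextOf φ` is `φ` on the family. [folklore] -/
theorem toFun_coextOf {k : ℕ} (φ : SingularSimplex X k → R) {σ : SingularSimplex X k}
    (hσ : σ ∈ 𝒮.carrier k) : 𝒮.toFun (𝒮.coextOf φ) σ = φ σ := by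
  rw [coextOf, (𝒰).toFun_incl 𝒮 𝒮.sub_le_univ _ hσ (Set.subset_univ _), subsetCochains.toFun_coext]

/-- `coextOf` is additive. [folklore] -/
theorem coextOf_add {k : ℕ} (φ φ' : SingularSimplex X k → R) :
    𝒮.coextOf (φ + φ') = 𝒮.coextOf φ + 𝒮.coextOf φ' := by
  rw [coextOf, subsetCochains.coext_add, Preadditive.comp_add]
  rfl

/-- `coextOf` is homogeneous. [folklore] -/
theorem coextOf_smul {k : ℕ} (r : R) (φ : SingularSimplex X k → R) :
    𝒮.coextOf (r • φ) = r • 𝒮.coextOf φ := by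
  rw [coextOf, subsetCochains.coext_smul, Linear.comp_smul]
  rfl

/-! ### Spans closed under front and back faces -/

/-- A simplex span is **closed under front and back faces** (true for `C(W)` and `C(A) + C(B)`,
whose membership only depends on the image of the simplex). [folklore] -/
structure FrontBackClosed : Prop where
  /-- front faces of family simplices are in the family -/
  front : ∀ {p n : ℕ} (h : p ≤ n) {σ : SingularSimplex X n}, σ ∈ 𝒮.carrier n →
    σ.frontFace h ∈ 𝒮.carrier p
  /-- back faces of family simplices are in the family -/
  back : ∀ {q n : ℕ} (h : q ≤ n) {σ : SingularSimplex X n}, σ ∈ 𝒮.carrier n →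
    σ.backFace h ∈ 𝒮.carrier q

/-- `C(W)` is closed under front and back faces. [folklore] -/
theorem frontBackClosed_ofSet (W : Set X) : (ofSet (R := R) W).FrontBackClosed where
  front h _ hσ := (SingularSimplex.range_frontFace_subset h _).trans hσ
  back h _ hσ := (SingularSimplex.range_backFace_subset h _).trans hσ

/-- `C(A) + C(B)` is closed under front and back faces. [folklore] -/
theorem frontBackClosed_ofSets (A B : Set X) : (ofSets (R := R) A B).FrontBackClosed where
  front h _ hσ := hσ.elim (fun h' ↦ Or.inl ((SingularSimplex.range_frontFace_subset h _).trans h'))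
    fun h' ↦ Or.inr ((SingularSimplex.range_frontFace_subset h _).trans h')
  back h _ hσ := hσ.elim (fun h' ↦ Or.inl ((SingularSimplex.range_backFace_subset h _).trans h'))
    fun h' ↦ Or.inr ((SingularSimplex.range_backFace_subset h _).trans h')

/-! ### The right cup product by a global cochain -/

variable {p d n : ℕ}

/-- **The right cup product `ψ ⌣ β ∈ Hom(𝒮ₙ, 𝑹)`** of a cochain `ψ ∈ Hom(𝒮ₚ, 𝑹)` of the span by
a global function cochain `β ∈ Cᵈ(X; R)`, `p + d = n`: the cochain of the Alexander–Whitney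
product of the function cochain of `ψ` with `β` (Hatcher 2002, §3.2 p. 206 and p. 209).
[cite: HatcherAT2002, §3.2 pp. 206, 209] -/
def cupRight (β : SingularSimplex X d → R) (h : p + d = n) (ψ : 𝒮.sub.toComplex.X p ⟶ 𝑹) :
    𝒮.sub.toComplex.X n ⟶ 𝑹 :=
  𝒮.coextOf (cochainCup h (𝒮.toFun ψ) β)

/-- **The cup product formula on the family**: `(ψ ⌣ β)(σ) = ψ(σ|[v₀…vₚ]) · β(σ|[vₚ…vₙ])`.
[cite: HatcherAT2002, §3.2 p. 206] -/
theorem toFun_cupRight (β : SingularSimplex X d → R) (h : p + d = n)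
    (ψ : 𝒮.sub.toComplex.X p ⟶ 𝑹) {σ : SingularSimplex X n} (hσ : σ ∈ 𝒮.carrier n) :
    𝒮.toFun (𝒮.cupRight β h ψ) σ = cochainCup h (𝒮.toFun ψ) β σ :=
  𝒮.toFun_coextOf _ hσ

/-- As function cochains on the family, `toFun (ψ ⌣ β) = toFun ψ ⌣ β`. [folklore] -/
theorem toFun_cupRight_eq (β : SingularSimplex X d → R) (h : p + d = n)
    (ψ : 𝒮.sub.toComplex.X p ⟶ 𝑹) {σ : SingularSimplex X n} (hσ : σ ∈ 𝒮.carrier n) :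
    𝒮.toFun (𝒮.cupRight β h ψ) σ = 𝒮.toFun ψ (σ.frontFace (by omega)) * β (σ.backFace (by omega)) := by
  rw [𝒮.toFun_cupRight β h ψ hσ, cochainCup_apply]

/-- `⌣ β` is additive. [folklore] -/
theorem cupRight_add (β : SingularSimplex X d → R) (h : p + d = n)
    (ψ ψ' : 𝒮.sub.toComplex.X p ⟶ 𝑹) :
    𝒮.cupRight β h (ψ + ψ') = 𝒮.cupRight β h ψ + 𝒮.cupRight β h ψ' := by
  rw [cupRight, 𝒮.toFun_add, map_add, LinearMap.add_apply, 𝒮.coextOf_add]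
  rfl

/-- `⌣ β` is homogeneous. [folklore] -/
theorem cupRight_smul (β : SingularSimplex X d → R) (h : p + d = n) (r : R)
    (ψ : 𝒮.sub.toComplex.X p ⟶ 𝑹) :
    𝒮.cupRight β h (r • ψ) = r • 𝒮.cupRight β h ψ := by
  rw [cupRight, 𝒮.toFun_smul, map_smul, LinearMap.smul_apply, 𝒮.coextOf_smul]
  rfl

/-- `⌣ β` as an `R`-linear map `Hom(𝒮ₚ, 𝑹) → Hom(𝒮ₙ, 𝑹)`. [cite: HatcherAT2002, §3.2 p. 206] -/
def cupRightₗ (β : SingularSimplex X d → R) (h : p + d = n) :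
    (𝒮.sub.toComplex.X p ⟶ 𝑹) →ₗ[R] (𝒮.sub.toComplex.X n ⟶ 𝑹) where
  toFun := 𝒮.cupRight β h
  map_add' := 𝒮.cupRight_add β h
  map_smul' := 𝒮.cupRight_smul β h

/-- `cupRightₗ` is `cupRight`. [folklore] -/
@[simp]
theorem cupRightₗ_apply (β : SingularSimplex X d → R) (h : p + d = n) (ψ : 𝒮.sub.toComplex.X p ⟶ 𝑹) :
    𝒮.cupRightₗ β h ψ = 𝒮.cupRight β h ψ := rfl

/-- **The Leibniz rule `δ(ψ ⌣ β) = δψ ⌣ β` for a global cocycle `β`** (Hatcher 2002, Lemma 3.6,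
the second term vanishing), on the cochains of a front/back-closed span.
[cite: HatcherAT2002, Lemma 3.6] -/
theorem d_cupRight (hS : 𝒮.FrontBackClosed) (β : SingularSimplex X d → R)
    (hβ : (singularCochainComplex R R X).d d (d + 1) β = 0) (h : p + d = n)
    (ψ : 𝒮.sub.toComplex.X p ⟶ 𝑹) :
    𝒮.cochains.d n (n + 1) (𝒮.cupRight β h ψ) =
      𝒮.cupRight β (show (p + 1) + d = n + 1 by omega) (𝒮.cochains.d p (p + 1) ψ) := by
  refine 𝒮.hom_ext_toFun fun τ hτ ↦ ?_
  rw [𝒮.toFun_d _ hτ, 𝒮.toFun_cupRight _ _ _ hτ, cochainCup_apply,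
    𝒮.toFun_d _ (hS.front _ hτ)]
  -- on `τ` the singular coboundary of `toFun (ψ ⌣ β)` is that of `toFun ψ ⌣ β`
  have hloc : (singularCochainComplex R R X).d n (n + 1) (𝒮.toFun (𝒮.cupRight β h ψ)) τ =
      (singularCochainComplex R R X).d n (n + 1) (cochainCup h (𝒮.toFun ψ) β) τ := by
    rw [singularCochainComplex.d_apply, singularCochainComplex.d_apply]
    refine Finset.sum_congr rfl fun i _ ↦ ?_
    rw [𝒮.toFun_cupRight _ _ _ (𝒮.face_mem' hτ i)]
  rw [hloc, d_cochainCup h, hβ, map_zero, smul_zero, add_zero]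
  rfl

/-- **`⌣ β` commutes with restriction** to a smaller front/back-closed span `𝒮' ≤ 𝒮` (Hatcher
2002, §3.2, naturality of the cup product under the inclusion). [cite: HatcherAT2002, §3.2 Prop. 3.10] -/
theorem incl_cupRight (𝒮' : SimplexSpan R X) (hle : 𝒮'.sub ≤ 𝒮.sub) (hS' : 𝒮'.FrontBackClosed)
    (hmem : ∀ {k} {σ : SingularSimplex X k}, σ ∈ 𝒮'.carrier k → σ ∈ 𝒮.carrier k)
    (β : SingularSimplex X d → R) (h : p + d = n) (ψ : 𝒮.sub.toComplex.X p ⟶ 𝑹) :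
    (Subcomplex.incl hle).f n ≫ 𝒮.cupRight β h ψ =
      𝒮'.cupRight β h ((Subcomplex.incl hle).f p ≫ ψ) := by
  refine 𝒮'.hom_ext_toFun fun σ hσ ↦ ?_
  rw [𝒮.toFun_incl 𝒮' hle _ hσ (hmem hσ), 𝒮.toFun_cupRight _ _ _ (hmem hσ),
    𝒮'.toFun_cupRight _ _ _ hσ, cochainCup_apply, cochainCup_apply,
    𝒮.toFun_incl 𝒮' hle _ (hS'.front _ hσ) (hmem (hS'.front _ hσ))]

end SimplexSpan

end Literature.AlgebraicTopology.SingularHomology
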